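import Summits.CriticalPhenomena.PercolationContinuityZ3.Theorems.SoloInformedHangingBridges
import Literature.Probability.Percolation.HalfSpaceHighDimStar
import Literature.Probability.Percolation.GrimmettMarstrandProofs
import Literature.Probability.Percolation.BernoulliPercolationProofs
import Literature.Barriers.CriticalPhenomena.GaussianDominationRouteLaceExpansionSymm
import HarnessLib

/-!
# The backbone threshold is `p_c` (solo seat `solo-CriticalPhenomena-informed`, S17′)

`robust v` (`SoloInformedHangingBridges.lean`) is the event that the open cluster of `v` is infinite
and stays infinite after closing any single edge; `B(p) := P_p(0 robust)` is the backbone density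
of portrait item S17 (`SoloInformedNoCriticalBackbone.lean`, `SoloInformedBackboneTwoPoint.lean`).
Here: **for every `d ≥ 2` and every `p > p_c(ℤ^d)`, `B(p) ≥ p² θ_ℍ(p)² > 0`**
(`sq_mul_sq_le_measureReal_robust`, `measureReal_robust_pos_of_criticalProb_lt`).

Proof. Let `up = e₀`, `ℍ⁺ = {1 ≤ x₀} = ℍ + up`, `ℍ⁻ = {x₀ ≤ -1} = -ℍ⁺`. The four events
`{⟨0, up⟩ open}`, `{up ↔ ∞ inside ℍ⁺}`, `{⟨0, -up⟩ open}`, `{-up ↔ ∞ inside ℍ⁻}` are determined by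
pairwise disjoint edge sets, so their intersection has probability `p · θ_ℍ(p) · p · θ_ℍ(p)`
(translation and point-reflection invariance of `P_p`, `bondPercolation_real_inter_of_disjoint`);
on the intersection `0` is robust: closing an edge outside `{⟨0,up⟩} ∪ E(ℍ⁺)` leaves the first
route to infinity intact (the event is determined by those edges), and closing an edge inside it
leaves the second route intact (disjointness). Finally `θ_ℍ(p) > 0` for `p > p_c(ℤ^d) = p_c(ℍ)`
(`GrimmettMarstrand1990_halfSpace_holds`, `theta_pos_of_criticalProb_lt_holds`).

So the threshold of `B` is exactly `p_c`, in both worlds; in the jump-world dichotomy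
`χ^f(p_c) = ∞ ∨ B(p_c) > 0` (`jumpWorld_dichotomy`) the second branch says that `B` does not vanish
at its own threshold. [folklore]

Tree anchors: `Literature.Barriers.CriticalPhenomena.negIso` (the point reflection `v ↦ -v` as an
automorphism of `ℤ^d`), `BGNd.up`, `BGNd.upperHalfSpace`, `BGNd.real_percolatesVia_upperHalfSpace_up`,
`BGNd.determinedBy_mem_edge`, `BGNd.edge_zero_up_notMem`, `BGNd.zdGraph_adj_zero_up`
(`HalfSpaceHighDimStar.lean`), `relabel_preimage_percolatesVia`,
`bondPercolation_real_preimage_relabel_iso`, `bondPercolation_cylinder`,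
`bondPercolation_real_inter_of_disjoint`, `determinedBy_iff`, `mem_percolatesVia_of_adj`.
-/

noncomputable section

namespace Summit.CriticalPhenomena.PercolationContinuityZ3.Theorems

open Literature.Probability.Percolation Literature.Probability.Percolation.BGNd
  Literature.Probability.LatticeModels SimpleGraph MeasureTheory
open Literature.Barriers.CriticalPhenomena (negIso negIso_apply)
open scoped ENNReal

namespace BackboneThreshold

variable {d : ℕ}

/-! ### Closing one edge -/

/-- Closing an edge a determined event does not look at preserves the event. [folklore] -/
theorem mem_sdiff_singleton_of_determinedBy {A : Set (BondConfig (Site d))} {S : Set (Sym2 (Site d))}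
    (hA : DeterminedBy A S) {ω : BondConfig (Site d)} (hω : ω ∈ A) {e : Sym2 (Site d)} (he : e ∉ S) :
    ω \ {e} ∈ A := by
  refine ((determinedBy_iff A S).1 hA ω (ω \ {e}) ?_).1 hω
  ext f
  simp only [Set.mem_inter_iff, Set.mem_sdiff, Set.mem_singleton_iff]
  constructor
  · rintro ⟨hf, hfS⟩
    exact ⟨⟨hf, fun h => he (h ▸ hfS)⟩, hfS⟩
  · rintro ⟨⟨hf, -⟩, hfS⟩
    exact ⟨hf, hfS⟩

/-! ### The reflected half-space `ℍ⁻ = {x₀ ≤ -1}` (point reflection `negIso : v ↦ -v`) -/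

section

variable [NeZero d]

/-- The reflection carries the steps of `ℍ⁺` onto the steps of `ℍ⁻`. [folklore] -/
theorem withinGraph_lowerHalfSpace_adj_neg (u w : Site d) :
    (withinGraph (zdGraph d) {x : Site d | x 0 ≤ -1}).Adj ((negIso d).toEquiv u) ((negIso d).toEquiv w) ↔
      (withinGraph (zdGraph d) (upperHalfSpace d)).Adj u w := by
  rw [withinGraph_adj, withinGraph_adj]
  have hadj : (zdGraph d).Adj ((negIso d).toEquiv u) ((negIso d).toEquiv w) ↔ (zdGraph d).Adj u w :=
    (negIso d).map_rel_iff'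
  rw [hadj]
  have hu : ((negIso d).toEquiv u) 0 = -u 0 := rfl
  have hw : ((negIso d).toEquiv w) 0 = -w 0 := rfl
  simp only [Set.mem_setOf_eq, mem_upperHalfSpace_iff, hu, hw]
  constructor
  · rintro ⟨h1, h2, h3⟩
    exact ⟨h1, by omega, by omega⟩
  · rintro ⟨h1, h2, h3⟩
    exact ⟨h1, by omega, by omega⟩

/-- Reflection invariance: `P_p(-up ↔ ∞ inside ℍ⁻) = θ_ℍ(p)`. [folklore] -/
theorem real_percolatesVia_lowerHalfSpace_neg_up (p : unitInterval) :
    (bondPercolation (zdGraph d) p).real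
        (percolatesVia (withinGraph (zdGraph d) {x : Site d | x 0 ≤ -1}) (-up)) =
      theta (halfSpaceGraph d) (halfSpaceOrigin d) p := by
  rw [← real_percolatesVia_upperHalfSpace_up p]
  have h := relabel_preimage_percolatesVia (negIso d).toEquiv
    (K := withinGraph (zdGraph d) (upperHalfSpace d))
    (K' := withinGraph (zdGraph d) {x : Site d | x 0 ≤ -1}) withinGraph_lowerHalfSpace_adj_neg up
  have hup : (negIso d).toEquiv up = -up := rfl
  rw [hup] at h
  rw [← h]
  exact (bondPercolation_real_preimage_relabel_iso (negIso d) p _).symm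

/-! ### The two routes to infinity -/

/-- `up ≠ 0`. [folklore] -/
theorem up_ne_zero : (up : Site d) ≠ 0 := by
  intro h
  have := congrFun h 0
  simp [up] at this

/-- Route 1 is determined by its edges. [folklore] -/
theorem determinedBy_routeUp : DeterminedBy ({ω : BondConfig (Site d) | s((0 : Site d), up) ∈ ω} ∩
      percolatesVia (withinGraph (zdGraph d) (upperHalfSpace d)) up) (({s((0 : Site d), up)} : Set (Sym2 (Site d))) ∪
      (withinGraph (zdGraph d) (upperHalfSpace d)).edgeSet) :=
  ((determinedBy_mem_edge _).mono Set.subset_union_left).inter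
    ((determinedBy_percolatesVia _ _).mono Set.subset_union_right)

/-- Route 2 is determined by its edges. [folklore] -/
theorem determinedBy_routeDown : DeterminedBy ({ω : BondConfig (Site d) | s((0 : Site d), -up) ∈ ω} ∩
      percolatesVia (withinGraph (zdGraph d) {x : Site d | x 0 ≤ -1}) (-up)) (({s((0 : Site d), -up)} : Set (Sym2 (Site d))) ∪
      (withinGraph (zdGraph d) {x : Site d | x 0 ≤ -1}).edgeSet) :=
  ((determinedBy_mem_edge _).mono Set.subset_union_left).inter
    ((determinedBy_percolatesVia _ _).mono Set.subset_union_right)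

/-- Route 1 is measurable. [folklore] -/
theorem measurableSet_routeUp : MeasurableSet ({ω : BondConfig (Site d) | s((0 : Site d), up) ∈ ω} ∩
      percolatesVia (withinGraph (zdGraph d) (upperHalfSpace d)) up) :=
  (measurableSet_mem _).inter (measurableSet_percolatesVia _ _)

/-- Route 2 is measurable. [folklore] -/
theorem measurableSet_routeDown : MeasurableSet ({ω : BondConfig (Site d) | s((0 : Site d), -up) ∈ ω} ∩
      percolatesVia (withinGraph (zdGraph d) {x : Site d | x 0 ≤ -1}) (-up)) :=
  (measurableSet_mem _).inter (measurableSet_percolatesVia _ _)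

/-- Every edge route 1 looks at has an endpoint with `x₀ ≥ 1` and both endpoints with `x₀ ≥ 0`;
we only need: both endpoints have `x₀ ≥ 0`. [folklore] -/
theorem nonneg_of_mem_edgesUp {a b : Site d} (h : s(a, b) ∈ (({s((0 : Site d), up)} : Set (Sym2 (Site d))) ∪
      (withinGraph (zdGraph d) (upperHalfSpace d)).edgeSet)) :
    0 ≤ a 0 ∧ 0 ≤ b 0 := by
  rcases h with h | h
  · rw [Set.mem_singleton_iff, Sym2.eq_iff] at h
    rcases h with ⟨rfl, rfl⟩ | ⟨rfl, rfl⟩ <;> simp [up]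
  · rw [mem_edgeSet_withinGraph] at h
    have ha := (mem_upperHalfSpace_iff.1 h.2.1)
    have hb := (mem_upperHalfSpace_iff.1 h.2.2)
    exact ⟨by omega, by omega⟩

/-- Every edge route 2 looks at has an endpoint with `x₀ ≤ -1`. [folklore] -/
theorem exists_neg_of_mem_edgesDown {a b : Site d} (h : s(a, b) ∈ (({s((0 : Site d), -up)} : Set (Sym2 (Site d))) ∪
      (withinGraph (zdGraph d) {x : Site d | x 0 ≤ -1}).edgeSet)) :
    a 0 ≤ -1 ∨ b 0 ≤ -1 := by
  rcases h with h | h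
  · rw [Set.mem_singleton_iff, Sym2.eq_iff] at h
    rcases h with ⟨rfl, rfl⟩ | ⟨rfl, rfl⟩ <;> simp [up]
  · rw [mem_edgeSet_withinGraph] at h
    exact Or.inl h.2.1

/-- The two routes look at disjoint sets of edges. [folklore] -/
theorem disjoint_edgesUp_edgesDown : Disjoint (({s((0 : Site d), up)} : Set (Sym2 (Site d))) ∪
      (withinGraph (zdGraph d) (upperHalfSpace d)).edgeSet) (({s((0 : Site d), -up)} : Set (Sym2 (Site d))) ∪
      (withinGraph (zdGraph d) {x : Site d | x 0 ≤ -1}).edgeSet) := by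
  rw [Set.disjoint_left]
  intro e he he'
  induction e using Sym2.ind with
  | _ a b =>
    obtain ⟨ha, hb⟩ := nonneg_of_mem_edgesUp he
    rcases exists_neg_of_mem_edgesDown he' with h | h <;> omega

/-- `P_p(route 1) = p · θ_ℍ(p)`. [folklore] -/
theorem real_routeUp (p : unitInterval) :
    (bondPercolation (zdGraph d) p).real ({ω : BondConfig (Site d) | s((0 : Site d), up) ∈ ω} ∩
      percolatesVia (withinGraph (zdGraph d) (upperHalfSpace d)) up) =
      (p : ℝ) * theta (halfSpaceGraph d) (halfSpaceOrigin d) p := by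
  rw [bondPercolation_real_inter_of_disjoint (zdGraph d) p
    (Set.disjoint_singleton_left.2 edge_zero_up_notMem) (determinedBy_mem_edge _)
    (determinedBy_percolatesVia _ _) (measurableSet_mem _) (measurableSet_percolatesVia _ _),
    bondPercolation_cylinder (zdGraph d) p ((mem_edgeSet _).2 zdGraph_adj_zero_up),
    real_percolatesVia_upperHalfSpace_up]

/-- The origin and `-up` are neighbours in `ℤ^d`. [folklore] -/
theorem zdGraph_adj_zero_neg_up : (zdGraph d).Adj 0 (-up : Site d) := by
  have h := (negIso d).map_rel_iff'.2 (zdGraph_adj_zero_up (d := d))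
  simpa using h

/-- The edge `⟨0, -up⟩` is not an edge of `ℍ⁻`. [folklore] -/
theorem edge_zero_neg_up_notMem :
    s((0 : Site d), -up) ∉ (withinGraph (zdGraph d) {x : Site d | x 0 ≤ -1}).edgeSet := by
  intro h
  rw [mem_edgeSet_withinGraph] at h
  have h0 : (0 : Site d) 0 ≤ -1 := h.2.1
  simp at h0

/-- `P_p(route 2) = p · θ_ℍ(p)`. [folklore] -/
theorem real_routeDown (p : unitInterval) :
    (bondPercolation (zdGraph d) p).real ({ω : BondConfig (Site d) | s((0 : Site d), -up) ∈ ω} ∩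
      percolatesVia (withinGraph (zdGraph d) {x : Site d | x 0 ≤ -1}) (-up)) =
      (p : ℝ) * theta (halfSpaceGraph d) (halfSpaceOrigin d) p := by
  rw [bondPercolation_real_inter_of_disjoint (zdGraph d) p
    (Set.disjoint_singleton_left.2 edge_zero_neg_up_notMem) (determinedBy_mem_edge _)
    (determinedBy_percolatesVia _ _) (measurableSet_mem _) (measurableSet_percolatesVia _ _),
    bondPercolation_cylinder (zdGraph d) p ((mem_edgeSet _).2 zdGraph_adj_zero_neg_up),
    real_percolatesVia_lowerHalfSpace_neg_up]

/-- `P_p(route 1 ∩ route 2) = p² θ_ℍ(p)²`. [folklore] -/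
theorem real_routeUp_inter_routeDown (p : unitInterval) :
    (bondPercolation (zdGraph d) p).real (({ω : BondConfig (Site d) | s((0 : Site d), up) ∈ ω} ∩
      percolatesVia (withinGraph (zdGraph d) (upperHalfSpace d)) up) ∩ ({ω : BondConfig (Site d) | s((0 : Site d), -up) ∈ ω} ∩
      percolatesVia (withinGraph (zdGraph d) {x : Site d | x 0 ≤ -1}) (-up))) =
      ((p : ℝ) * theta (halfSpaceGraph d) (halfSpaceOrigin d) p) ^ 2 := by
  rw [bondPercolation_real_inter_of_disjoint (zdGraph d) p disjoint_edgesUp_edgesDown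
    determinedBy_routeUp determinedBy_routeDown measurableSet_routeUp measurableSet_routeDown,
    real_routeUp, real_routeDown, sq]

/-! ### On both routes the origin is robust -/

/-- Route 1 puts the origin in an infinite open cluster. [folklore] -/
theorem infinite_of_mem_routeUp {ω : BondConfig (Site d)} (h : ω ∈ ({ω : BondConfig (Site d) | s((0 : Site d), up) ∈ ω} ∩
      percolatesVia (withinGraph (zdGraph d) (upperHalfSpace d)) up)) :
    (openCluster ω (0 : Site d)).Infinite := by
  have h' : ω ∈ percolatesVia (⊤ : SimpleGraph (Site d)) 0 :=
    mem_percolatesVia_of_adj (K := ⊤) le_top ((top_adj _ _).2 up_ne_zero.symm) h.1 h.2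
  exact percolatesVia_subset_percolatesAt _ _ h'

/-- Route 2 puts the origin in an infinite open cluster. [folklore] -/
theorem infinite_of_mem_routeDown {ω : BondConfig (Site d)} (h : ω ∈ ({ω : BondConfig (Site d) | s((0 : Site d), -up) ∈ ω} ∩
      percolatesVia (withinGraph (zdGraph d) {x : Site d | x 0 ≤ -1}) (-up))) :
    (openCluster ω (0 : Site d)).Infinite := by
  have hne : (0 : Site d) ≠ -up := fun h0 => up_ne_zero (neg_eq_zero.1 h0.symm)
  have h' : ω ∈ percolatesVia (⊤ : SimpleGraph (Site d)) 0 :=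
    mem_percolatesVia_of_adj (K := ⊤) le_top ((top_adj _ _).2 hne) h.1 h.2
  exact percolatesVia_subset_percolatesAt _ _ h'

/-- **On both routes the origin is robust**: any single closed edge misses one of the two routes.
[folklore] -/
theorem routeUp_inter_routeDown_subset_robust :
    ({ω : BondConfig (Site d) | s((0 : Site d), up) ∈ ω} ∩
      percolatesVia (withinGraph (zdGraph d) (upperHalfSpace d)) up) ∩ ({ω : BondConfig (Site d) | s((0 : Site d), -up) ∈ ω} ∩
      percolatesVia (withinGraph (zdGraph d) {x : Site d | x 0 ≤ -1}) (-up)) ⊆ robust (0 : Site d) := by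
  intro ω hω
  refine mem_robust_iff.2 ⟨infinite_of_mem_routeUp hω.1, fun e => ?_⟩
  by_cases he : e ∈ (({s((0 : Site d), up)} : Set (Sym2 (Site d))) ∪
      (withinGraph (zdGraph d) (upperHalfSpace d)).edgeSet)
  · have he' : e ∉ (({s((0 : Site d), -up)} : Set (Sym2 (Site d))) ∪
      (withinGraph (zdGraph d) {x : Site d | x 0 ≤ -1}).edgeSet) := Set.disjoint_left.1 disjoint_edgesUp_edgesDown he
    exact infinite_of_mem_routeDown (mem_sdiff_singleton_of_determinedBy determinedBy_routeDown hω.2 he')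
  · exact infinite_of_mem_routeUp (mem_sdiff_singleton_of_determinedBy determinedBy_routeUp hω.1 he)

end

end BackboneThreshold

open BackboneThreshold

variable {d : ℕ}

/-- **`p² θ_ℍ(p)² ≤ B(p)`** for bond percolation on `ℤ^d`, every `d ≥ 1` and every `p`: two open edges
`⟨0, ±e₀⟩` followed by infinite open paths inside the disjoint half-spaces `{x₀ ≥ 1}`, `{x₀ ≤ -1}` make
the origin robust. [folklore] -/
theorem sq_mul_sq_le_measureReal_robust [NeZero d] (p : unitInterval) :
    ((p : ℝ) * theta (halfSpaceGraph d) (halfSpaceOrigin d) p) ^ 2 ≤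
      (bondPercolation (zdGraph d) p).real (robust (0 : Site d)) := by
  rw [← real_routeUp_inter_routeDown p]
  exact measureReal_mono routeUp_inter_routeDown_subset_robust

/-- **The backbone threshold is `p_c`**: for `d ≥ 2` and `p > p_c(ℤ^d)`, `B(p) = P_p(0 robust) > 0`
(Grimmett–Marstrand: `p_c(ℍ) = p_c(ℤ^d)`, so `θ_ℍ(p) > 0`). [folklore] -/
theorem measureReal_robust_pos_of_criticalProb_lt [NeZero d] (hd : 2 ≤ d) (p : unitInterval)
    (hp : criticalProb (zdGraph d) (0 : Site d) < p) :
    0 < (bondPercolation (zdGraph d) p).real (robust (0 : Site d)) := by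
  have hpc : criticalProb (halfSpaceGraph d) (halfSpaceOrigin d) < p := by
    rw [GrimmettMarstrand1990_halfSpace_holds d hd]; exact hp
  have hθ : 0 < theta (halfSpaceGraph d) (halfSpaceOrigin d) p :=
    theta_pos_of_criticalProb_lt_holds (halfSpaceGraph d) (halfSpaceOrigin d) p hpc
  have hp0 : 0 < (p : ℝ) := lt_of_le_of_lt (criticalProb_mem_Icc _ _).1 hp
  exact lt_of_lt_of_le (by positivity) (sq_mul_sq_le_measureReal_robust p)

/-- The case `d = 3` at the sub-problem's critical parameter: for every `p > p_c(ℤ³)` the backbone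
density is positive, `P_p(0 robust) > 0`; so in the jump-world dichotomy
`χ^f(p_c) = ∞ ∨ P_{p_c}(0 robust) > 0` the second branch asserts that the backbone density does not
vanish at its own threshold `p_c`. [folklore] -/
theorem measureReal_robust_pos_Z3 (p : unitInterval) (hp : criticalProbI 3 < p) :
    0 < (bondPercolation (zdGraph 3) p).real (robust (0 : Site 3)) := by
  have hp' : criticalProb (zdGraph 3) (0 : Site 3) < p := by
    have : ((criticalProbI 3 : unitInterval) : ℝ) < p := hp
    simpa using this
  exact measureReal_robust_pos_of_criticalProb_lt (by norm_num) p hp'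

end Summit.CriticalPhenomena.PercolationContinuityZ3.Theorems
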